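import Mathlib
import Literature.Analysis.FluidPDE.VectorCalculus
import Literature.Analysis.FluidPDE.SelfSimilar
import Literature.Analysis.FluidPDE.MildSolution
import Literature.Analysis.FluidPDE.NSBoundedMildSmoothing
import Literature.Analysis.FluidPDE.NSLerayOseenRepresentation
import Literature.Analysis.FluidPDE.OseenZoomCovariance
import Literature.Analysis.FluidPDE.TypeIAncientMild
import Summits.NavierStokesRegularity.NavierStokesRegularity.Theses.UnthreadedRigidityDoor
import Summits.NavierStokesRegularity.NavierStokesRegularity.Theorems.ThreadingFluxCentreJetDefs
import Summits.NavierStokesRegularity.NavierStokesRegularity.Theorems.ThreadingFluxPlatonicDefs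
import Summits.NavierStokesRegularity.NavierStokesRegularity.Theorems.ThreadingFluxPlatonicSteadyStratum
import Summits.NavierStokesRegularity.NavierStokesRegularity.Theorems.ThreadingFluxPlatonicSymmetryAlgebra
import Summits.NavierStokesRegularity.NavierStokesRegularity.Theorems.ThreadingFluxPlatonicAncientGlue
import HarnessLib

/-!
# Crux `PoloidalLiouville` (stmt-NavierStokesRegularity-1222, W1) / `UnthreadedRigidity` (stmt-…-27585, W2), crux idea «platonic-germ-sieve»
# (ns-idea-15 g11, V27): duality-mild ⇒ honest Oseen-mild in a symmetry class fixing no vector, and W1|_O ⇐ ⟨27585⟩ BY NAME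

Support file (Theorems-side; seat ns-wall-eng-8 g7, cell `ns-wall-extremal`; `--supports stmt-NavierStokesRegularity-1222 --as helper`; 0 kit).
It removes the one explicit hypothesis of the ancient glue `Platonic.ancientOctahedral_eq_zero_of_unthreadedRigidity_of_oseenMild`
(`ThreadingFluxPlatonicAncientGlue.lean`) — HONEST Oseen-mildness — for the class of the card's typed statement `SymmetricPoloidalLiouville G`:

* `Platonic.exists_const_ancient_oseen` — Koch–Nadirashvili–Seregin–Šverák's Lemma 3.1 in TWO-TIME form for the tree's duality class
  `IsBoundedAncientMildSolution ν u` (slices a.e.-strongly measurable, jointly measurable on `(s,t) × ℝ³`): for all `s < t < 0` there is a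
  constant `c` with `u t = e^{ν(t−s)Δ}u s − B^ν_s(u,u)(t) − c` a.e. (the parasitic drift of KNSS 2009 §1 p. 3 / Lemma 3.1 — the ONLY freedom
  of the duality class between two times).  It is the time shift of the landed `exists_const_oseenMild_of_bounded_isMildNSSolutionOn`
  (`NSLerayOseenRepresentation.lean`), cited by name.
* ★ `Platonic.oseenMild_of_equivariant` — if moreover `u` is continuous on `(−∞,0) × ℝ³` and `G`-equivariant at every negative time for
  a set `G` of (coercions of) linear isometries FIXING NO VECTOR, then the HONEST pointwise Oseen identity
  `u t x = e^{(t−s)Δ}u s (x) − B¹_s(u,u)(t)(x)` holds for all `s < t < 0` and all `x`: the caloric extension and the Oseen tensor are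
  `O(3)`-covariant (`heatExtension_conj_linearIsometryEquiv`, `oseenDuhamel_symm_conj_linearIsometryEquiv`, `OseenZoomCovariance.lean`), so
  the parasitic constant is fixed by every symmetry of `u`, hence vanishes.
* `Platonic.exists_linearIsometryEquiv_of_mem_octahedral` — the rotations of the cube are linear isometries.
* ★★ `Platonic.symmetricPoloidalLiouville_octahedral_of_unthreadedRigidity : UnthreadedRigidity → SymmetricPoloidalLiouville octahedral` —
  the card's typed Prop `SymmetricPoloidalLiouville octahedral` (W1 RESTRICTED TO THE O-CLASS, conclusion `v ≡ 0`) follows from the W2 door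
  ⟨27585⟩ BY NAME, with no honest-mildness hypothesis left (the previous file's `…_of_oseenMild` + the conversion above).
* `Platonic.not_unthreadedRigidity_of_symmetricCounterexample_octahedral` — the negation home: a member of the card's typed negation object
  `SymmetricCounterexample octahedral` refutes ⟨27585⟩.

HONEST LABEL: conditional glue strictly below W1/W2 (hypothesis ⟨27585⟩); `OctahedralCentreRigidity`, ⟨1222⟩, ⟨27585⟩ and NS regularity are OPEN
and NOT touched; information-grade (movement 0).

## References
* G. Koch, N. Nadirashvili, G. Seregin, V. Šverák, Liouville theorems for the Navier–Stokes equations and applications, Acta Math. 203 (2009)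
  83–105, arXiv:0709.3599, §1 p. 3 (parasitic solutions), §3 Lemma 3.1 / Remark 3.1 (the drift `b(t)`), §4 p. 8 (`B(u,v)`).
* A. J. Majda, A. L. Bertozzi, Vorticity and Incompressible Flow, CUP 2002, §1.2 Prop. 1.1 (iii) (rotation covariance).
-/

-- the summit and its single sub-problem share the name (CONVENTIONS §1)
set_option linter.dupNamespace false

noncomputable section

open Set Function Filter Metric MeasureTheory
open scoped RealInnerProductSpace Topology
open Literature.Analysis.FluidPDE
open Summit.NavierStokesRegularity.NavierStokesRegularity.Theses
open Summit.NavierStokesRegularity.NavierStokesRegularity.Theorems.PoloidalLiouville.CentreJet (E3)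

namespace Summit.NavierStokesRegularity.NavierStokesRegularity.Theorems.PoloidalLiouville.Platonic

/-! ## KNSS Lemma 3.1 in two-time form for the ancient duality class -/

/-- **KNSS 2009, Lemma 3.1 / Remark 3.1, two-time form for bounded ancient mild solutions (duality class).**  Let `ν > 0` and let `u` be a
bounded ancient mild solution in the tree's duality form (`IsBoundedAncientMildSolution ν u`) whose negative-time slices are a.e.-strongly
measurable and which is jointly a.e.-strongly measurable on `(s, t) × ℝ³` for some `s < t < 0`.  Then there is a constant `c` with
`u t = e^{ν(t−s)Δ}u s − B^ν_s(u,u)(t) − c` a.e.  Proof: the time shift `w τ = u (τ + s)` is a bounded duality-form mild solution on `(0, t−s]`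
from the weakly divergence-free datum `w 0 = u s` (`IsMildNSSolutionBetween.comp_add_right_zero`, `isMildNSSolutionFrom_self_iff`), so the
landed `exists_const_oseenMild_of_bounded_isMildNSSolutionOn` applies; the Duhamel term shifts back by `oseenDuhamel_comp_sub_right`. -/
theorem exists_const_ancient_oseen {ν : ℝ} (hν : 0 < ν) {u : ℝ → E3 → E3} (hu : IsBoundedAncientMildSolution ν u)
    (hmeas : ∀ t < 0, AEStronglyMeasurable (u t) volume) {s t : ℝ} (hst : s < t) (ht : t < 0)
    (hjm : AEStronglyMeasurable (uncurry u) ((volume : Measure (ℝ × E3)).restrict (Ioo s t ×ˢ univ))) :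
    ∃ c : E3, u t =ᵐ[volume] fun x =>
      Literature.Analysis.UnboundedOperators.heatExtension (u s) (ν * (t - s)) x - oseenDuhamel ν s u u t x - c := by
  -- the time shift
  set w : ℝ → E3 → E3 := fun τ => u (τ + s) with hw
  have hT : 0 < t - s := sub_pos.2 hst
  obtain ⟨C, hC⟩ := hu.2
  have hM : (0 : ℝ) < max C 1 := lt_max_of_lt_right one_pos
  have hbdw : ∀ τ ∈ Icc (0 : ℝ) (t - s), ∀ y, ‖w τ y‖ ≤ max C 1 := fun τ hτ y =>
    (hC (τ + s) (show τ + s < 0 by linarith [hτ.2]) y).trans (le_max_left _ _)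
  have hslw : ∀ τ ∈ Icc (0 : ℝ) (t - s), AEStronglyMeasurable (w τ) volume := fun τ hτ =>
    hmeas (τ + s) (by linarith [hτ.2])
  have hmildw : IsMildNSSolutionOn (Ioc 0 (t - s)) ν 0 (w 0) w := by
    refine ⟨fun τ hτ => hu.1.1 (τ + s) (by linarith [hτ.2]), fun τ hτ => ?_⟩
    rw [isMildNSSolutionFrom_self_iff]
    exact (hu.1.2 (0 + s) (τ + s) (by linarith [hτ.1]) (by linarith [hτ.2])).comp_add_right_zero
  -- joint measurability of the shifted field on `(0, t - s) × ℝ³`: pull back along the measure-preserving shear `(τ, y) ↦ (τ + s, y)`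
  have hjmw : AEStronglyMeasurable (uncurry w) ((volume : Measure (ℝ × E3)).restrict (Ioo 0 (t - s) ×ˢ univ)) := by
    set g : ℝ × E3 → ℝ × E3 := Prod.map (fun τ : ℝ => τ + s) id with hg
    have hgmp : MeasurePreserving g (volume : Measure (ℝ × E3)) (volume : Measure (ℝ × E3)) :=
      (measurePreserving_add_right volume s).prod (MeasurePreserving.id (volume : Measure E3))
    have hpre : g ⁻¹' (Ioo s t ×ˢ (univ : Set E3)) = Ioo 0 (t - s) ×ˢ univ := by
      ext ⟨τ, y⟩
      simp only [hg, Prod.map, id, mem_preimage, mem_prod, mem_Ioo, mem_univ, and_true]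
      constructor
      · rintro ⟨h1, h2⟩; exact ⟨by linarith, by linarith⟩
      · rintro ⟨h1, h2⟩; exact ⟨by linarith, by linarith⟩
    have hres := hgmp.restrict_preimage
      ((measurableSet_Ioo (a := s) (b := t)).prod (MeasurableSet.univ : MeasurableSet (univ : Set E3)))
    rw [hpre] at hres
    have hcomp : uncurry w = uncurry u ∘ g := by
      funext ⟨τ, y⟩; rfl
    rw [hcomp]
    exact hjm.comp_measurePreserving hres
  have hdiv0 : IsWeaklyDivFree (w 0) := by
    have h := hu.1.1 s (hst.trans ht)
    simpa [hw] using h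
  obtain ⟨c, hc⟩ := exists_const_oseenMild_of_bounded_isMildNSSolutionOn hν hT hmildw hjmw hslw hM hbdw hdiv0 ⟨hT, le_rfl⟩
  refine ⟨c, ?_⟩
  have hwT : w (t - s) = u t := by simp [hw]
  have hw0 : w 0 = u s := by simp [hw]
  have hB : ∀ x, oseenDuhamel ν 0 w w (t - s) x = oseenDuhamel ν s u u t x := by
    intro x
    have h := oseenDuhamel_comp_sub_right ν 0 (t - s) (-s) u u x
    simp only [sub_neg_eq_add, zero_add, sub_add_cancel] at h
    exact h
  rw [hwT, hw0] at hc
  simp only [hB] at hc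
  exact hc

/-! ## Symmetry kills the parasitic constant -/

/-- ★ **Duality-mild ⇒ honest Oseen-mild in a symmetry class fixing no vector.**  Let `u` be a bounded ancient mild solution (`ν = 1`,
duality class) with a.e.-strongly measurable negative-time slices, continuous on `(−∞,0) × ℝ³`, and `G`-equivariant at every negative
time, where every element of `G` is (the coercion of) a linear isometry of `ℝ³` and `G` fixes no non-zero vector.  Then the HONEST pointwise
Oseen identity `u t x = e^{(t−s)Δ}u s (x) − B¹_s(u,u)(t)(x)` holds for all `s < t < 0` and all `x`.  Proof: by `exists_const_ancient_oseen`
the identity holds a.e. up to a constant `c`; all three pieces are continuous (`contDiff_heatExtension_holds`, `continuous_oseenDuhamel_slice`),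
so it holds everywhere; the caloric extension and the Duhamel term of a `G`-equivariant field are `G`-equivariant
(`heatExtension_conj_linearIsometryEquiv`, `oseenDuhamel_symm_conj_linearIsometryEquiv`), whence `g c = c` for every `g ∈ G`, and `c = 0`. -/
theorem oseenMild_of_equivariant {G : Set (E3 → E3)} (hG : FixesNoVector G)
    (hGiso : ∀ g ∈ G, ∃ L : E3 ≃ₗᵢ[ℝ] E3, ∀ x, L x = g x)
    {u : ℝ → E3 → E3} (hu : IsBoundedAncientMildSolution 1 u)
    (hmeas : ∀ t < 0, AEStronglyMeasurable (u t) volume)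
    (hcont : ContinuousOn (uncurry u) (Iio 0 ×ˢ univ))
    (hequi : ∀ t < 0, IsEquivariant G (u t)) :
    ∀ s ∈ Iio (0 : ℝ), ∀ t ∈ Iio (0 : ℝ), s < t → ∀ x, u t x =
      Literature.Analysis.UnboundedOperators.heatExtension (u s) (t - s) x - oseenDuhamel 1 s u u t x := by
  intro s hs t ht hst
  have hs0 : s < 0 := hs
  have ht0 : t < 0 := ht
  -- joint measurability on `(s, t) × ℝ³` from continuity
  have hjm : AEStronglyMeasurable (uncurry u) ((volume : Measure (ℝ × E3)).restrict (Ioo s t ×ˢ univ)) :=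
    (hcont.mono fun p hp => ⟨lt_trans hp.1.2 ht0, mem_univ _⟩).aestronglyMeasurable
      (measurableSet_Ioo.prod MeasurableSet.univ)
  obtain ⟨c, hc⟩ := exists_const_ancient_oseen one_pos hu hmeas hst ht0 hjm
  rw [one_mul] at hc
  set H : E3 → E3 := Literature.Analysis.UnboundedOperators.heatExtension (u s) (t - s) with hHdef
  set B : E3 → E3 := oseenDuhamel 1 s u u t with hBdef
  -- continuity of the three pieces
  obtain ⟨C, hC⟩ := hu.2
  have hslice : ∀ τ < (0 : ℝ), Continuous (u τ) := fun τ hτ =>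
    hcont.comp_continuous (continuous_const.prodMk continuous_id) fun y => ⟨hτ, mem_univ y⟩
  have hHc : Continuous H := by
    have hm : MemLp (u s) ⊤ (volume : Measure E3) := memLp_top_of_bound (hmeas s hs0) C (Eventually.of_forall (hC s hs0))
    exact (Literature.Analysis.UnboundedOperators.contDiff_heatExtension_holds hm le_top (sub_pos.2 hst)).continuous
  have hBc : Continuous B :=
    continuous_oseenDuhamel_slice one_pos (le_max_right C 0) hjm hjm
      (fun τ hτ y => (hC τ (lt_trans hτ.2 ht0) y).trans (le_max_left _ _))
      (fun τ hτ y => (hC τ (lt_trans hτ.2 ht0) y).trans (le_max_left _ _)) hst le_rfl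
  -- the identity holds everywhere
  have hpt : u t = fun x => H x - B x - c :=
    ((hslice t ht0).ae_eq_iff_eq volume ((hHc.sub hBc).sub continuous_const)).1 hc
  -- the constant is fixed by every symmetry
  have hfix : ∀ g ∈ G, g c = c := by
    intro g hg
    obtain ⟨L, hL⟩ := hGiso g hg
    have hequiL : ∀ τ < (0 : ℝ), ∀ y, u τ (L y) = L (u τ y) := fun τ hτ y => by
      rw [hL y, hL (u τ y)]; exact hequi τ hτ g hg y
    have hptL : ∀ τ < (0 : ℝ), ∀ z, L (u τ (L.symm z)) = u τ z := fun τ hτ z => by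
      rw [← hequiL τ hτ, L.apply_symm_apply]
    have hfunL : ∀ τ < (0 : ℝ), (fun z => L (u τ (L.symm z))) = u τ := fun τ hτ =>
      funext (hptL τ hτ)
    -- covariance of the caloric term
    have hHcov : ∀ y, H (L y) = L (H y) := by
      intro y
      have h := heatExtension_conj_linearIsometryEquiv L (u s) (t - s) (L y)
      rw [hfunL s hs0, L.symm_apply_apply] at h
      exact h
    -- covariance of the Duhamel term (the integrand only sees negative times)
    have hBcov : ∀ y, B (L y) = L (B y) := by
      intro y
      have h := oseenDuhamel_symm_conj_linearIsometryEquiv L.symm 1 s u u t (L y)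
      rw [LinearIsometryEquiv.symm_symm, L.symm_apply_apply] at h
      rw [hBdef, ← h, oseenDuhamel_apply, oseenDuhamel_apply]
      refine setIntegral_congr_fun measurableSet_Ioo fun τ hτ => ?_
      simp only [hptL τ (lt_trans hτ.2 ht0)]
    have e0 : u t 0 = H 0 - B 0 - c := congrFun hpt 0
    have e1 : u t (L 0) = H (L 0) - B (L 0) - c := congrFun hpt (L 0)
    rw [hHcov, hBcov, hequiL t ht0, e0, map_sub, map_sub] at e1
    rw [← hL c]
    exact sub_right_inj.1 e1
  have hc0 : c = 0 := hG c hfix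
  intro x
  have hx := congrFun hpt x
  rw [hc0, sub_zero] at hx
  exact hx

/-! ## The rotations of the cube are linear isometries -/

/-- Every rotation of the cube `cubeRot σ s` (signs `±1`) is a linear isometry of `ℝ³`. -/
theorem exists_linearIsometryEquiv_of_mem_octahedral {g : E3 → E3} (hg : g ∈ octahedral) :
    ∃ L : E3 ≃ₗᵢ[ℝ] E3, ∀ x, L x = g x := by
  obtain ⟨σ, s, ⟨hs, -⟩, rfl⟩ := hg
  have hlin : IsLinearMap ℝ (cubeRot σ s) := ⟨cubeRot_add σ s, cubeRot_smul σ s⟩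
  have hsq : ∀ i, s i ^ 2 = 1 := fun i => by rcases hs i with h | h <;> simp [h]
  have hnorm : ∀ x : E3, ‖cubeRot σ s x‖ = ‖x‖ := by
    intro x
    have h2 : ‖cubeRot σ s x‖ ^ 2 = ‖x‖ ^ 2 := by
      rw [EuclideanSpace.real_norm_sq_eq, EuclideanSpace.real_norm_sq_eq]
      calc ∑ i, (cubeRot σ s x) i ^ 2 = ∑ i, x (σ i) ^ 2 := by
            refine Finset.sum_congr rfl fun i _ => ?_
            simp only [cubeRot, PiLp.toLp_apply, mul_pow, hsq, one_mul]
        _ = ∑ i, x i ^ 2 := Equiv.sum_comp σ (fun i => x i ^ 2)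
    exact (pow_left_inj₀ (norm_nonneg _) (norm_nonneg _) two_ne_zero).1 h2
  let Li : E3 →ₗᵢ[ℝ] E3 := { toLinearMap := hlin.mk' _, norm_map' := hnorm }
  exact ⟨Li.toLinearIsometryEquiv rfl, fun x => rfl⟩

/-! ## W1 restricted to the octahedral class, from the W2 door, BY NAME -/

/-- ★★ **`SymmetricPoloidalLiouville octahedral` ⇐ ⟨27585⟩ `UnthreadedRigidity`, BY NAME.**  If `UnthreadedRigidity` holds, every bounded
ancient mild solution (KNSS duality class, `ν = 1`) with a.e.-strongly measurable slices, smooth on `(−∞,0) × ℝ³`, unthreaded about `0`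
and O-equivariant at every negative time VANISHES on `t < 0`.  (`oseenMild_of_equivariant` supplies honest Oseen-mildness — O fixes no
vector, `octahedral_fixesNoVector`, and consists of linear isometries — and `ancientOctahedral_eq_zero_of_unthreadedRigidity_of_oseenMild`
concludes.)  Conditional on ⟨27585⟩; ⟨1222⟩, ⟨27585⟩, `OctahedralCentreRigidity` OPEN. -/
theorem symmetricPoloidalLiouville_octahedral_of_unthreadedRigidity (h27585 : UnthreadedRigidityDoor.UnthreadedRigidity) :
    SymmetricPoloidalLiouville octahedral := by
  intro v hv hmeas hsm hun hequi
  have hmild := oseenMild_of_equivariant octahedral_fixesNoVector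
    (fun g hg => exists_linearIsometryEquiv_of_mem_octahedral hg) hv hmeas hsm.continuousOn hequi
  exact ancientOctahedral_eq_zero_of_unthreadedRigidity_of_oseenMild h27585 v hv hsm hmild hun hequi

/-- **Negation home.**  A member of the card's typed negation object `SymmetricCounterexample octahedral` (a bounded ancient mild solution,
smooth, unthreaded about `0`, O-equivariant, non-zero at some negative time) refutes ⟨27585⟩ `UnthreadedRigidity`. -/
theorem not_unthreadedRigidity_of_symmetricCounterexample_octahedral (hc : SymmetricCounterexample octahedral) :
    ¬ UnthreadedRigidityDoor.UnthreadedRigidity := by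
  intro h
  obtain ⟨v, hv, hmeas, hsm, hun, hequi, t, ht, x, hx⟩ := hc
  exact hx (symmetricPoloidalLiouville_octahedral_of_unthreadedRigidity h v hv hmeas hsm hun hequi t ht x)

end Summit.NavierStokesRegularity.NavierStokesRegularity.Theorems.PoloidalLiouville.Platonic

end
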